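import Summits.ResolutionOfSingularities.ResolutionOfSingularities.Theorems.PurelyInseparableDim4PiPlateau
import HarnessLib

/-!
# Π, corollary: the letter `ω_q = d − [V_q]` does not increase on `V_q`-active MODE-0 edges (cell `res-dim4-pi`)

[OURS · counted 0]  Nothing here is a statement about resolution of singularities in dimension ≥ 4 /
characteristic `p`, which is NOT proved.  Blueprint `PiPlateau-typing-blueprint.md` (res-dim4-idea-5,
d8a3f498d0e42ada) §F «ω-COROLLARY» of the landed plateau law `Plateau.piPlateau_holds` (p661587):

* `omegaLetter q Δ F = ω_q(F, Δ) := d − [V_q]` (`d = residualOrder Δ F`, `[V_q] = 1` iff `Plateau.IsVActive q Δ F`),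
  an `ℕ∞`-valued letter (`⊤` only for `F = 0`); by `one_le_residualOrder_of_isVActive` the subtraction is genuine;
* **`omegaLetter_step_le`** — on a MODE-0 edge (`t j = 0`) from a `q`-fold (`q = p^e`) `V_q`-active state:
  `ω_q′ ≤ ω_q` (from `pi_of_isVActive`: `d′ < d ⇒ ω′ ≤ d′ ≤ d − 1 = ω`; `d′ = d ⇒ V_q′ = 1 ⇒ ω′ = ω`).

Persistence / no-rise for ONE point letter under point blow-ups; not a decrease at jumps; the `V_q`-inactive half of
any move law is NOT here.  Typed and proved by res-dim4-typ-1.  Supports stmt-ResolutionOfSingularities-16155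
(helper).  bears_on: LADDER-RESOLUTION:D157-DOOR2 (res-dim4-pi · I-5-5 Π · ω corollary).
-/

set_option linter.dupNamespace false -- mandated namespace of this single-conjunct summit

namespace Summit.ResolutionOfSingularities.ResolutionOfSingularities.Theorems.PIDim4

namespace Plateau

open MvPolynomial Finset
open Literature.AlgebraicGeometry.Resolution
open Literature.AlgebraicGeometry.Resolution.Hauser2010
open Literature.AlgebraicGeometry.Resolution.CentreBlowup
open Literature.Barriers.ResolutionOfSingularities
open Literature.Barriers.ResolutionOfSingularities.HauserPerlega
open Summit.ResolutionOfSingularities.ResolutionOfSingularities.Theorems.Rescue.BedCylinderTransport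
  (residualOrder_eq_ordZero_sub)

variable {σ : Type*} [Fintype σ] [DecidableEq σ] {K : Type*} [Field K] [DecidableEq K]

open Classical in
omit [Fintype σ] [DecidableEq σ] [DecidableEq K] in
/-- **The letter `ω_q(F, Δ) = d − [V_q]`** (res-dim4-idea-5 CARD I-5-5): residual order minus the activity bit.
[OURS · res-dim4-idea-5 CARD I-5-5] -/
noncomputable def omegaLetter (q : ℕ) (Δ : Finset σ) (F : MvPolynomial σ K) : ℕ∞ :=
  residualOrder Δ F - (if IsVActive q Δ F then 1 else 0)

/-- **`ω_q` DOES NOT INCREASE on a `V_q`-active MODE-0 edge** (`t j = 0`, parent `q`-fold, `q = p^e`; every field of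
characteristic `p`, any number of variables). [folklore] -/
theorem omegaLetter_step_le (p : ℕ) [Fact p.Prime] [CharP K p] (e : ℕ) (s : CState σ K) (j : σ) (t : σ → K)
    (ht : t j = 0) (hq : ((p ^ e : ℕ) : ℕ∞) ≤ ordZero s.F) (hV : IsVActive (p ^ e) s.exc s.F) :
    omegaLetter (p ^ e) (CentreBlowup.step (p ^ e) Finset.univ j t s).exc (CentreBlowup.step (p ^ e) Finset.univ j t s).F ≤
      omegaLetter (p ^ e) s.exc s.F := by
  obtain ⟨hne, hle, himp⟩ := pi_of_isVActive p e s j t ht hq hV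
  have h1 := one_le_residualOrder_of_isVActive (p ^ e) s.exc s.F hV
  unfold omegaLetter
  rw [if_pos hV]
  obtain ⟨A, hA, -⟩ := hV
  have hF0 : s.F ≠ 0 := MvPolynomial.support_nonempty.mp ⟨A, hA⟩
  obtain ⟨o, ho⟩ := exists_ordZero_eq_natCast hF0
  obtain ⟨-, hd⟩ := residualOrder_eq_ordZero_sub s.exc ho
  obtain ⟨o', ho'⟩ := exists_ordZero_eq_natCast hne
  obtain ⟨-, hd'⟩ := residualOrder_eq_ordZero_sub (CentreBlowup.step (p ^ e) Finset.univ j t s).exc ho'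
  rw [hd, hd'] at hle himp
  rw [hd] at h1
  rw [hd, hd', show (1 : ℕ∞) = ((1 : ℕ) : ℕ∞) from rfl]
  have hle' := Nat.cast_le.mp hle
  have h1' : 1 ≤ o - (exceptionalExp s.exc s.F).degree := by exact_mod_cast h1
  split_ifs with hV'
  · rw [← ENat.coe_sub, ← ENat.coe_sub, Nat.cast_le]
    omega
  · have hlt : o' - (exceptionalExp (CentreBlowup.step (p ^ e) Finset.univ j t s).exc
        (CentreBlowup.step (p ^ e) Finset.univ j t s).F).degree < o - (exceptionalExp s.exc s.F).degree := by
      refine lt_of_le_of_ne hle' fun h => hV' (himp ?_)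
      rw [h]
    rw [show ((0 : ℕ∞)) = ((0 : ℕ) : ℕ∞) from rfl, ← ENat.coe_sub, ← ENat.coe_sub, Nat.cast_le]
    omega

end Plateau

end Summit.ResolutionOfSingularities.ResolutionOfSingularities.Theorems.PIDim4
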